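import Mathlib

/-!
# LEMMA G of ROW C-041 — the cut-vertex transfer as a finite-sum identity: the state spaces (p6, gen 25)

mine-3's LEMMA G (proofs/C-041.md §9) and the block-tree reduction of (O-CUBE) (§10 (a)–(b)) rest on one piece of
bookkeeping: when `G⁺ = 𝒫 ∪ Γ″` is glued at a vertex `u″` (no terminal edges, never deleted by `Γ″`), a state of the
whole is a PAIR `(σ, x′)` of a state `σ` of the gadget `𝒫` and a pattern `x′` of the sub-problem `Γ″`, and
* `Good_t(σ, x′) ⟺ G_t^σ ∨ (ρ_t^σ ∧ G_t″(x′))` — the endpoints of the gadget are reached iff `G_t^σ`, those of the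
  sub-problem iff `u″` is reached on side `t` in `σ` (`ρ_t^σ`) and `G_t″(x′)`;
* `valid(σ, x′) ⟺ V^σ ∨ V″(x′)` (the predicate `V_∨`: some red terminal edge lands in `K`).

This file has THE ABSTRACT OBJECTS of that bookkeeping: a `Space X` = a finite type of states with weights
`w : X → ℕ` (the multiplicities of the outside patterns), the Good bits `G₁ G₂`, validity `V` (a Good state is
valid), the weight `wt = 3·[G₁] + 3·[G₂] − 2`, the sums `Φ` (over the valid states), `Φall` (over all states), the
counts `cnt S p` (weighted), `I` (the invalid states), `NV` / `NnotV` / `N`, `m₁ S ρ` / `m₂ S ρ` (`¬G_t ∧ ρ`), and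
the GLUE `glue P ρ₁ ρ₂ Q` on `Σ × X` with the combination rules above.  The identity of LEMMA G is
`C041CutGlueIdentity`, its bound, the criterion (★) and the (INV) form `C041CutGlueBound`, the multiplicativity of
§10 (b) `C041CutGlueProduct`.  NOT claimed here: that the states of a skeleton `G⁺ = 𝒫 ∪_{u″} Γ″` ARE such pairs
with these rules (the three-line graph argument of §9; the percolation-side reduction of LEMMA G is not typed).
-/

namespace PercRepro

namespace CutGlue

open Finset

/-- An indicator in `ℤ`. -/
noncomputable def ind (p : Prop) : ℤ := by classical exact if p then 1 else 0

/-- A weighted finite state space with two Good bits and a validity predicate; a Good state is valid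
(`Good_t ⟹ X_{3−t}`, S3 of the port problem). -/
structure Space (X : Type*) where
  /-- the weight (multiplicity) of a state -/
  w : X → ℕ
  /-- `Good₁` -/
  G₁ : X → Prop
  /-- `Good₂` -/
  G₂ : X → Prop
  /-- validity -/
  V : X → Prop
  /-- a `Good₁` state is valid -/
  hG₁ : ∀ x, G₁ x → V x
  /-- a `Good₂` state is valid -/
  hG₂ : ∀ x, G₂ x → V x

namespace Space

variable {X : Type*}

/-- The weight `3·[G₁] + 3·[G₂] − 2` of a state. -/
noncomputable def wt (S : Space X) (x : X) : ℤ := 3 * ind (S.G₁ x) + 3 * ind (S.G₂ x) - 2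

section Sums

variable [Fintype X]

open Classical in
/-- The weighted count of the states satisfying `p`. -/
noncomputable def cnt (S : Space X) (p : X → Prop) : ℤ := ∑ x, if p x then (S.w x : ℤ) else 0

open Classical in
/-- `Φ`: the weight sum over the valid states. -/
noncomputable def phi (S : Space X) : ℤ := ∑ x, if S.V x then (S.w x : ℤ) * S.wt x else 0

/-- `Φ_all`: the weight sum over all states. -/
noncomputable def phiAll (S : Space X) : ℤ := ∑ x, (S.w x : ℤ) * S.wt x

/-- `I`: the weighted number of invalid states. -/
noncomputable def I (S : Space X) : ℤ := S.cnt fun x => ¬ S.V x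

/-- `#_w{V}`: the weighted number of valid states. -/
noncomputable def NV (S : Space X) : ℤ := S.cnt S.V

/-- `#_w{¬V}`: the weighted number of invalid states (the same count as `I`, under its §9 name). -/
noncomputable def NnotV (S : Space X) : ℤ := S.cnt fun x => ¬ S.V x

/-- `N`: the total weight. -/
noncomputable def N (S : Space X) : ℤ := S.cnt fun _ => True

/-- `m₁ S ρ`: the weighted number of states with `¬G₁` in which `ρ` holds (`u″` reached on side `1`). -/
noncomputable def m₁ (S : Space X) (ρ : X → Prop) : ℤ := S.cnt fun x => ¬ S.G₁ x ∧ ρ x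

/-- `m₂ S ρ`: the weighted number of states with `¬G₂` in which `ρ` holds (`u″` reached on side `2`). -/
noncomputable def m₂ (S : Space X) (ρ : X → Prop) : ℤ := S.cnt fun x => ¬ S.G₂ x ∧ ρ x

end Sums

end Space

/-- THE GLUE along a cut vertex: the states of `𝒫 ∪_{u″} Γ″` are the pairs `(σ, x′)`, with the product weight,
`Good_t = G_t^σ ∨ (ρ_t σ ∧ G_t x′)` and validity `V^σ ∨ V x′`. -/
def glue {Y X : Type*} (P : Space Y) (ρ₁ ρ₂ : Y → Prop) (Q : Space X) : Space (Y × X) where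
  w s := P.w s.1 * Q.w s.2
  G₁ s := P.G₁ s.1 ∨ (ρ₁ s.1 ∧ Q.G₁ s.2)
  G₂ s := P.G₂ s.1 ∨ (ρ₂ s.1 ∧ Q.G₂ s.2)
  V s := P.V s.1 ∨ Q.V s.2
  hG₁ s h := by
    rcases h with h | ⟨_, h⟩
    · exact Or.inl (P.hG₁ _ h)
    · exact Or.inr (Q.hG₁ _ h)
  hG₂ s h := by
    rcases h with h | ⟨_, h⟩
    · exact Or.inl (P.hG₂ _ h)
    · exact Or.inr (Q.hG₂ _ h)

section Basic

/-- The indicator of a true proposition. -/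
theorem ind_pos {p : Prop} (h : p) : ind p = 1 := by
  unfold ind
  simp [h]

/-- The indicator of a false proposition. -/
theorem ind_neg {p : Prop} (h : ¬ p) : ind p = 0 := by
  unfold ind
  simp [h]

/-- An indicator is nonnegative. -/
theorem ind_nonneg (p : Prop) : 0 ≤ ind p := by
  unfold ind
  split_ifs <;> norm_num

/-- An indicator is at most one. -/
theorem ind_le_one (p : Prop) : ind p ≤ 1 := by
  unfold ind
  split_ifs <;> norm_num

/-- The indicator of a disjunction with a conjunction: `[a ∨ (r ∧ b)] = [a] + [¬a ∧ r]·[b]`. -/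
theorem ind_or_and (a r b : Prop) : ind (a ∨ (r ∧ b)) = ind a + ind (¬ a ∧ r) * ind b := by
  unfold ind
  by_cases ha : a <;> by_cases hr : r <;> by_cases hb : b <;> simp [ha, hr, hb]

/-- An `if` with value `0` in the negative branch is an indicator times the value. -/
theorem ite_eq_ind_mul (p : Prop) [Decidable p] (w : ℤ) : (if p then w else 0) = ind p * w := by
  by_cases h : p
  · rw [if_pos h, ind_pos h, one_mul]
  · rw [if_neg h, ind_neg h, zero_mul]

variable {X : Type*}

/-- An invalid state has weight `−2`. -/
theorem Space.wt_of_not_V (S : Space X) {x : X} (h : ¬ S.V x) : S.wt x = -2 := by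
  unfold Space.wt
  rw [ind_neg (fun hG => h (S.hG₁ x hG)), ind_neg (fun hG => h (S.hG₂ x hG))]
  norm_num

/-- The weight is at least `−2`. -/
theorem Space.neg_two_le_wt (S : Space X) (x : X) : -2 ≤ S.wt x := by
  unfold Space.wt
  have h1 := ind_nonneg (S.G₁ x)
  have h2 := ind_nonneg (S.G₂ x)
  omega

/-- The weight is at most `4`. -/
theorem Space.wt_le_four (S : Space X) (x : X) : S.wt x ≤ 4 := by
  unfold Space.wt
  have h1 := ind_le_one (S.G₁ x)
  have h2 := ind_le_one (S.G₂ x)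
  omega

variable [Fintype X]

open Classical in
/-- A weighted count is nonnegative. -/
theorem Space.cnt_nonneg (S : Space X) (p : X → Prop) : 0 ≤ S.cnt p := by
  unfold Space.cnt
  apply Finset.sum_nonneg
  intro x _
  split_ifs <;> positivity

open Classical in
/-- Weighted counts are monotone in the predicate. -/
theorem Space.cnt_mono (S : Space X) {p q : X → Prop} (h : ∀ x, p x → q x) : S.cnt p ≤ S.cnt q := by
  unfold Space.cnt
  apply Finset.sum_le_sum
  intro x _
  by_cases hp : p x
  · rw [if_pos hp, if_pos (h x hp)]
  · rw [if_neg hp]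
    split_ifs <;> positivity

open Classical in
/-- Weighted counts of equivalent predicates agree. -/
theorem Space.cnt_congr (S : Space X) {p q : X → Prop} (h : ∀ x, p x ↔ q x) : S.cnt p = S.cnt q := by
  unfold Space.cnt
  apply Finset.sum_congr rfl
  intro x _
  simp only [h x]

open Classical in
/-- A weighted count splits along a predicate: `cnt p = cnt (p ∧ q) + cnt (p ∧ ¬ q)`. -/
theorem Space.cnt_split (S : Space X) (p q : X → Prop) :
    S.cnt p = S.cnt (fun x => p x ∧ q x) + S.cnt (fun x => p x ∧ ¬ q x) := by
  unfold Space.cnt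
  rw [← Finset.sum_add_distrib]
  apply Finset.sum_congr rfl
  intro x _
  by_cases hp : p x <;> by_cases hq : q x <;> simp [hp, hq]

/-- `N = NV + NnotV`. -/
theorem Space.N_eq (S : Space X) : S.N = S.NV + S.NnotV := by
  unfold Space.N Space.NV Space.NnotV
  rw [S.cnt_split (fun _ => True) S.V]
  congr 1 <;> apply S.cnt_congr <;> intro x <;> simp

/-- `I = NnotV` by definition. -/
theorem Space.I_eq_NnotV (S : Space X) : S.I = S.NnotV := rfl

open Classical in
/-- `Φ_all = Φ − 2·I`: the invalid states carry weight `−2` each. -/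
theorem Space.phiAll_eq (S : Space X) : S.phiAll = S.phi - 2 * S.I := by
  unfold Space.phiAll Space.phi Space.I Space.cnt
  rw [Finset.mul_sum, ← Finset.sum_sub_distrib]
  apply Finset.sum_congr rfl
  intro x _
  by_cases hV : S.V x
  · simp [hV]
  · rw [if_neg hV, if_pos hV, S.wt_of_not_V hV]
    ring

end Basic

end CutGlue

end PercRepro
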